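import Literature.IUT.HodgeArakelov.BadPrimeGaussianMonoidsGenuineRecordGaloisProofs

/-!
# [IUTchII] Cor 3.5 (ii) "⥤" (Galois clause) at the genuine `θ_env` data of `X̲̲_K` for ANY family of inversion actions —
# in particular print's OUTER inversion `ι_Ÿ` (Rmk 1.4.1 (ii)); proof-only re-statement of `…GenuineRecordGaloisProofs`

S. Mochizuki, *Inter-universal Teichmüller theory II*, kurims Dec-2020 manuscript, Cor 3.5 (ii) p. 95 ("each `Ψ_ξ(M^Θ_*)` is
equipped with a natural action by `G_v(M^Θ_*▶)_{⟨F_l^⋇⟩}`"), Prop 3.1 (i)(ii) pp. 87–88, Prop 2.2 (i) p. 66, Rmk 1.4.1 (ii) p. 28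
[cite: Mochizuki2012, Cor 3.5 (ii) p.95]. Claim key DISPUTED (D-0012). PROOF-ONLY companion (abc-iut cell, layer L6, seat
abc-iut-w4-d004 gen 3; node **IUTchII:Cor3.5(ii)**, Galois clause; sub-DAG row Cor-35.ii.r10). NO definition, NO `Prop` fact,
NO instance.

WHY THIS FILE. abc-iut-w4-d004 gen 2's `mrange_pi_diagonalStable'_thetaEnvRecordKummer(_of_mem_thetaEnv)` (p425081) states the
Galois clause for abc-iut-w4-d019's v1 record `EtaleLevels.thetaEnvRecordKummer … ι₀` whose "inversions" are conjugates of the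
INNER action of an element `ι₀ ∈ Π^tp_{X̲̲}` — a DEGENERATE choice by w4-d019's own v2 reading correction
(`ThetaEnvDataRecordModel.lean`; print's `ι_Ÿ` is OUTER). The proof depends on the record only through the bridge
`ThetaEnvData.toRecord` (ambient module, `conj`, `Ψ_cns = κ(O)`, `toRecord_topClass`), NOT on the inversion family; HERE the same
two theorems are stated for `(EtaleLevels.thetaEnvData …).toRecord (h1LimConjMulAut …) (h1LimKummerOn c hA hfi O) iota` with an
ARBITRARY family `iota` (abc-iut-w4-d030's shape), exactly as this seat's `…GenuineRecordRestrictionIsoFamily.lean` does for the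
restriction-iso clause:
* `conj_toRecord_apply` (`rfl`), `topClass_toRecord_family` (every `θ ∈ θ^{i₀}_env` is a top-level class — `toRecord_topClass`),
* `mrange_pi_diagonalStable'_toRecord`, **`mrange_pi_diagonalStable'_toRecord_of_mem_thetaEnv`** — the Galois clause: for every
  `θ ∈ θ^{i₀}_env(𝕄_*)` (any `iota`), the Gaussian monoid `Ψ_ξ = r(M^×_TM · θ^ℕ)` is stable under the diagonal labeled
  `G_v`-action; inputs = the evaluation-sections DATA (`s_t` continuous into `Π^tp_{Ÿ̲̲}`, common `φ₀`, sections of an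
  augmentation `q` whose kernel acts trivially on `O`, restrictions pinned) and the model data (`c`, `O`, `hO`).
Nothing here asserts a disputed claim or takes a side on [IUTchIII] Cor 3.12; typed ≠ proved ≠ endorsed.
-/

noncomputable section

namespace Literature.IUT.HodgeArakelov

namespace EtaleLevels

open Literature.AnabelianGeometry.EtaleTheta CohomologySystemOfContH1 EtaleThetaDataOfSetting TemperedThetaMonoids
  BadPrimeGaussianMonoids

variable {p : ℕ} [Fact p.Prime] {D : Literature.AnabelianGeometry.EtaleTheta.ThetaSetting p}
  {E : D.EtaleThetaData} {l : ℕ} (C : E.DoubleUnderline l) (hC : D.Compat) (hS : D.Sec2Hyps)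
  (hl : l.Prime) (hp2 : p ≠ 2) (hpl : p ≠ l) (hζ : ∃ ζ : D.K, IsPrimitiveRoot ζ (4 * l))
  (mods : ∀ M : ℕ+, D.CyclotomeMod l M)
  (f : contCocycles D.toTheta D.DeltaTheta C.GtpYdduu) (hf : f ∈ C.rootCocycles hC)
  (hmods : ∀ (M M' : ℕ+) (h : (M : ℕ) ∣ (M' : ℕ)) (x : D.lDeltaTheta l),
    MuN.red p M M' h ((mods M').red x) = (mods M).red x)
  (h15 : Literature.AnabelianGeometry.EtaleTheta.ThetaSetting.Prop15iii E hC) (L : C.CuspLabels)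
  (hZ : ∀ M : ℕ+, Nonempty (ModelCyclotomes.lDeltaQuot (C.rigidData (mods M) hC hS h15 L) ≃*
    Literature.IUT.HodgeTheaters.ZHat))
  (hcharY : EtaleThetaDataOfSetting.PiYddCharacteristic C)
  (hlim : Function.Bijective (rigidLimHom C hC hS hl hp2 hpl hζ mods f hf hmods h15 L hZ))
  [(EtaleThetaDataOfSetting.PiYdd C).Normal]
  {A : Type} [CommGroup A] [MulDistribMulAction (Pi C) A] [TopologicalSpace A] [RootableBy A ℕ]
  (c : CyclotomeCoefficients (phi C) (D.lDeltaTheta l) A)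
  (hA : ∀ b : A, IsOpen (MulAction.stabilizer (Pi C) b : Set (Pi C)))
  (hfi : ∀ b : A, (MulAction.stabilizer (Pi C) b).FiniteIndex)
  (O : Submonoid A) (hO : ∀ (σ : Pi C) (b : A), b ∈ O → σ • b ∈ O)
  {Iota : Type}
  (iota : Iota → ((thetaEnvData C hC hS hl hp2 hpl hζ mods f hf hmods h15 L hZ hcharY hlim).D.coh.lim ≃+
    (thetaEnvData C hC hS hl hp2 hpl hζ mods f hf hmods h15 L hZ hcharY hlim).D.coh.lim))
  {Lbl : Type*} {P₀ : TopGroup.{0}} (φ₀ : P₀ →* D.GtpTheta) (s : Lbl → (P₀ →* Pi C))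
  (hι : ∀ t, Continuous ((MonoidHom.id (Pi C)).comp (s t)))
  (hN : ∀ t, (⊤ : Subgroup P₀).map ((MonoidHom.id (Pi C)).comp (s t)) ≤ PiYdd C)
  (hφ : ∀ t, (phi C).comp ((MonoidHom.id (Pi C)).comp (s t)) = φ₀)

include hO in
/-- **IUTchII:Cor3.5(ii)** (kurims p.95) "each `Ψ_ξ(M^Θ_*)` is equipped with a natural action by `G_v(M^Θ_*▶)_{⟨F_l^⋇⟩}`"
**AT THE GENUINE `θ_env` DATA, ANY inversion family `iota`** (record `(thetaEnvData …).toRecord …`) of the natural system `𝕄_*` of `X̲̲_K`: diagonal `G_v,⟨F_l^⋇⟩`-stability of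
the Gaussian monoid `Ψ_ξ = r(M^×_TM · θ^ℕ)`, for `θ ∈ θ^ι_env`, label-wise continuous evaluation sections `s_t` into
`Π^tp_{Ÿ̲̲}` with common coefficient action `φ₀`, sections of an augmentation `q` whose kernel acts trivially on `𝒪^▷`,
restrictions pinned to `h1LimCongr ∘ s_t^*` — every junction hypothesis of the Cor 3.5 (ii) family DISCHARGED, the
identification tautological (`hψ`, `hθtop` kept as `rfl`-shaped binders). [cite: Mochizuki2012, Cor 3.5 (ii) p.95] -/
theorem mrange_pi_diagonalStable'_toRecord
    {K : Type*} [Group K] (q : Pi C →* K) (hq : ∀ x : Pi C, q x = 1 → ∀ a ∈ O, x • a = a) (w : P₀ →* K)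
    (hsec : ∀ t g, q (s t g) = w g)
    (θ : ((thetaEnvData C hC hS hl hp2 hpl hζ mods f hf hmods h15 L hZ hcharY hlim).toRecord
        (h1LimConjMulAut (phi C) (D.lDeltaTheta l) (PiYdd C)) (h1LimKummerOn (phi C) (D.lDeltaTheta l) (PiYdd C) c hA hfi O)
        iota).H)
    (hθtop : AddEquiv.additiveMultiplicative (h1Lim (phi C) (D.lDeltaTheta l) (PiYdd C) ⊥) (Additive.ofMul θ) ∈
      Set.range ((cohomologySystemOfContH1 (phi C) (D.lDeltaTheta l) (PiYdd C)).toLim ⊤))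
    (hψ : ∀ (g : Pi C)
      (y : ((thetaEnvData C hC hS hl hp2 hpl hζ mods f hf hmods h15 L hZ hcharY hlim).toRecord
        (h1LimConjMulAut (phi C) (D.lDeltaTheta l) (PiYdd C)) (h1LimKummerOn (phi C) (D.lDeltaTheta l) (PiYdd C) c hA hfi O)
        iota).H),
      AddEquiv.additiveMultiplicative (h1Lim (phi C) (D.lDeltaTheta l) (PiYdd C) ⊥) (Additive.ofMul
        (((thetaEnvData C hC hS hl hp2 hpl hζ mods f hf hmods h15 L hZ hcharY hlim).toRecord
        (h1LimConjMulAut (phi C) (D.lDeltaTheta l) (PiYdd C)) (h1LimKummerOn (phi C) (D.lDeltaTheta l) (PiYdd C) c hA hfi O)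
        iota).conj g y)) =
        h1LimConj (phi C) (D.lDeltaTheta l) (PiYdd C) g (AddEquiv.additiveMultiplicative (h1Lim (phi C) (D.lDeltaTheta l) (PiYdd C) ⊥) (Additive.ofMul y)))
    (R : Lbl → (((thetaEnvData C hC hS hl hp2 hpl hζ mods f hf hmods h15 L hZ hcharY hlim).toRecord
        (h1LimConjMulAut (phi C) (D.lDeltaTheta l) (PiYdd C)) (h1LimKummerOn (phi C) (D.lDeltaTheta l) (PiYdd C) c hA hfi O)
        iota).H →*
      Multiplicative (h1Lim φ₀ (D.lDeltaTheta l) (⊤ : Subgroup P₀) ⊥)))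
    (hR : ∀ t y, Multiplicative.toAdd (R t y) =
      h1LimCongr (D.lDeltaTheta l) ⊤ (hφ t) ⊥
        (h1LimComap (phi C) (D.lDeltaTheta l) ((MonoidHom.id (Pi C)).comp (s t)) (hι t) (hN t)
          (AddEquiv.additiveMultiplicative (h1Lim (phi C) (D.lDeltaTheta l) (PiYdd C) ⊥) (Additive.ofMul y))))
    (t₀ : Lbl) (g : P₀) :
    (MonoidHom.mrange (MonoidHom.pi fun t =>
        (R t).comp (splitMonoid
          ((thetaEnvData C hC hS hl hp2 hpl hζ mods f hf hmods h15 L hZ hcharY hlim).toRecord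
        (h1LimConjMulAut (phi C) (D.lDeltaTheta l) (PiYdd C)) (h1LimKummerOn (phi C) (D.lDeltaTheta l) (PiYdd C) c hA hfi O)
        iota).units
          (Submonoid.powers θ)).subtype)).map
        (piIso Lbl (h1LimConjMulAut φ₀ (D.lDeltaTheta l) ⊤ g)).toMonoidHom =
      MonoidHom.mrange (MonoidHom.pi fun t =>
        (R t).comp (splitMonoid
          ((thetaEnvData C hC hS hl hp2 hpl hζ mods f hf hmods h15 L hZ hcharY hlim).toRecord
        (h1LimConjMulAut (phi C) (D.lDeltaTheta l) (PiYdd C)) (h1LimKummerOn (phi C) (D.lDeltaTheta l) (PiYdd C) c hA hfi O)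
        iota).units
          (Submonoid.powers θ)).subtype) :=
  mrange_pi_diagonalStable'_ofKummerHom_labelwise
    ((thetaEnvData C hC hS hl hp2 hpl hζ mods f hf hmods h15 L hZ hcharY hlim).toRecord
        (h1LimConjMulAut (phi C) (D.lDeltaTheta l) (PiYdd C)) (h1LimKummerOn (phi C) (D.lDeltaTheta l) (PiYdd C) c hA hfi O)
        iota)
    (MulDistribMulAction.toMulAut (Pi C) A) O (fun σ b hb => hO σ b hb)
    (h1LimKummerOn (phi C) (D.lDeltaTheta l) (PiYdd C) c hA hfi O) (phi C) φ₀ (D.lDeltaTheta l) (PiYdd C)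
    (MonoidHom.id (Pi C)) (AddEquiv.additiveMultiplicative (h1Lim (phi C) (D.lDeltaTheta l) (PiYdd C) ⊥)) s hι hN hφ
    (ThetaEnvData.toRecord_constantMonoid _ _ _ _)
    (fun (σ : Pi C) m => h1LimKummerOn_smul (phi C) (D.lDeltaTheta l) (PiYdd C) c hA hfi O σ m
      ⟨σ • (m : A), hO σ m m.2⟩ rfl)
    q (fun x hx a ha => hq x hx a ha) w hsec (fun g y => hψ g y) θ hθtop R hR t₀ g

/-- Bookkeeping, PROVED: the conjugation datum of the genuine record IS the conjugation action `h1LimConj` read through the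
tautological identification `Additive (Multiplicative lim) ≃ lim` (`rfl`). [cite: Mochizuki2012, Prop 3.1 (i) p.87] -/
theorem conj_toRecord_apply (g : Pi C)
    (y : ((thetaEnvData C hC hS hl hp2 hpl hζ mods f hf hmods h15 L hZ hcharY hlim).toRecord
        (h1LimConjMulAut (phi C) (D.lDeltaTheta l) (PiYdd C)) (h1LimKummerOn (phi C) (D.lDeltaTheta l) (PiYdd C) c hA hfi O)
        iota).H) :
    AddEquiv.additiveMultiplicative (h1Lim (phi C) (D.lDeltaTheta l) (PiYdd C) ⊥) (Additive.ofMul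
      (((thetaEnvData C hC hS hl hp2 hpl hζ mods f hf hmods h15 L hZ hcharY hlim).toRecord
        (h1LimConjMulAut (phi C) (D.lDeltaTheta l) (PiYdd C)) (h1LimKummerOn (phi C) (D.lDeltaTheta l) (PiYdd C) c hA hfi O)
        iota).conj g y)) =
      h1LimConj (phi C) (D.lDeltaTheta l) (PiYdd C) g
        (AddEquiv.additiveMultiplicative (h1Lim (phi C) (D.lDeltaTheta l) (PiYdd C) ⊥) (Additive.ofMul y)) := rfl

/-- Bookkeeping, PROVED: every `θ ∈ θ^ι_env(𝕄_*)` of the genuine record is a TOP-LEVEL class of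
`lim_J H¹(Π^tp_{Ÿ̲̲} ∩ J, l·Δ_Θ)` (abc-iut-w4-d004 `toRecord_topClass`; identity coefficient transport).
[cite: Mochizuki2012, Prop 1.5 (iii) p.30] -/
theorem topClass_toRecord_family {i₀ : Iota}
    {θ : ((thetaEnvData C hC hS hl hp2 hpl hζ mods f hf hmods h15 L hZ hcharY hlim).toRecord
        (h1LimConjMulAut (phi C) (D.lDeltaTheta l) (PiYdd C)) (h1LimKummerOn (phi C) (D.lDeltaTheta l) (PiYdd C) c hA hfi O)
        iota).H}
    (hθ : θ ∈ ((thetaEnvData C hC hS hl hp2 hpl hζ mods f hf hmods h15 L hZ hcharY hlim).toRecord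
        (h1LimConjMulAut (phi C) (D.lDeltaTheta l) (PiYdd C)) (h1LimKummerOn (phi C) (D.lDeltaTheta l) (PiYdd C) c hA hfi O)
        iota).thetaEnv i₀) :
    AddEquiv.additiveMultiplicative (h1Lim (phi C) (D.lDeltaTheta l) (PiYdd C) ⊥) (Additive.ofMul θ) ∈
      Set.range ((cohomologySystemOfContH1 (phi C) (D.lDeltaTheta l) (PiYdd C)).toLim ⊤) :=
  toRecord_topClass (thetaEnvData C hC hS hl hp2 hpl hζ mods f hf hmods h15 L hZ hcharY hlim)
    (CohomologySystemOfContH1.h1LimConjMulAut (phi C) (D.lDeltaTheta l) (PiYdd C))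
    (h1LimKummerOn (phi C) (D.lDeltaTheta l) (PiYdd C) c hA hfi O)
    iota
    (phi C) (D.lDeltaTheta l) (PiYdd C)
    (AddEquiv.additiveMultiplicative (h1Lim (phi C) (D.lDeltaTheta l) (PiYdd C) ⊥)) (fun y _ => ⟨y, rfl⟩) hθ

include hO in
/-- **IUTchII:Cor3.5(ii)** (kurims p.95) **AT THE GENUINE RECORD, structural form**: for EVERY `θ ∈ θ^ι_env(𝕄_*)` of
the record `(thetaEnvData …).toRecord (h1LimConjMulAut …) (h1LimKummerOn c hA hfi O) iota`, the Gaussian monoid `Ψ_ξ = r(M^×_TM · θ^ℕ)` is stable under the diagonal labeled `G_v`-action —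
inputs = the DATA of the label-wise evaluation sections (`s_t` continuous into `Π^tp_{Ÿ̲̲}`, common `φ₀`, sections of an
augmentation `q` whose kernel acts trivially on `𝒪^▷`, restrictions pinned) and of the model (`c`, `O`, `hO`); no junction,
identification or bookkeeping hypothesis remains. [cite: Mochizuki2012, Cor 3.5 (ii) p.95] -/
theorem mrange_pi_diagonalStable'_toRecord_of_mem_thetaEnv
    {K : Type*} [Group K] (q : Pi C →* K) (hq : ∀ x : Pi C, q x = 1 → ∀ a ∈ O, x • a = a) (w : P₀ →* K)
    (hsec : ∀ t g, q (s t g) = w g) {i₀ : Iota}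
    {θ : ((thetaEnvData C hC hS hl hp2 hpl hζ mods f hf hmods h15 L hZ hcharY hlim).toRecord
        (h1LimConjMulAut (phi C) (D.lDeltaTheta l) (PiYdd C)) (h1LimKummerOn (phi C) (D.lDeltaTheta l) (PiYdd C) c hA hfi O)
        iota).H}
    (hθ : θ ∈ ((thetaEnvData C hC hS hl hp2 hpl hζ mods f hf hmods h15 L hZ hcharY hlim).toRecord
        (h1LimConjMulAut (phi C) (D.lDeltaTheta l) (PiYdd C)) (h1LimKummerOn (phi C) (D.lDeltaTheta l) (PiYdd C) c hA hfi O)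
        iota).thetaEnv i₀)
    (R : Lbl → (((thetaEnvData C hC hS hl hp2 hpl hζ mods f hf hmods h15 L hZ hcharY hlim).toRecord
        (h1LimConjMulAut (phi C) (D.lDeltaTheta l) (PiYdd C)) (h1LimKummerOn (phi C) (D.lDeltaTheta l) (PiYdd C) c hA hfi O)
        iota).H →*
      Multiplicative (h1Lim φ₀ (D.lDeltaTheta l) (⊤ : Subgroup P₀) ⊥)))
    (hR : ∀ t y, Multiplicative.toAdd (R t y) =
      h1LimCongr (D.lDeltaTheta l) ⊤ (hφ t) ⊥
        (h1LimComap (phi C) (D.lDeltaTheta l) ((MonoidHom.id (Pi C)).comp (s t)) (hι t) (hN t)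
          (AddEquiv.additiveMultiplicative (h1Lim (phi C) (D.lDeltaTheta l) (PiYdd C) ⊥) (Additive.ofMul y))))
    (t₀ : Lbl) (g : P₀) :
    (MonoidHom.mrange (MonoidHom.pi fun t =>
        (R t).comp (splitMonoid
          ((thetaEnvData C hC hS hl hp2 hpl hζ mods f hf hmods h15 L hZ hcharY hlim).toRecord
        (h1LimConjMulAut (phi C) (D.lDeltaTheta l) (PiYdd C)) (h1LimKummerOn (phi C) (D.lDeltaTheta l) (PiYdd C) c hA hfi O)
        iota).units
          (Submonoid.powers θ)).subtype)).map
        (piIso Lbl (h1LimConjMulAut φ₀ (D.lDeltaTheta l) ⊤ g)).toMonoidHom =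
      MonoidHom.mrange (MonoidHom.pi fun t =>
        (R t).comp (splitMonoid
          ((thetaEnvData C hC hS hl hp2 hpl hζ mods f hf hmods h15 L hZ hcharY hlim).toRecord
        (h1LimConjMulAut (phi C) (D.lDeltaTheta l) (PiYdd C)) (h1LimKummerOn (phi C) (D.lDeltaTheta l) (PiYdd C) c hA hfi O)
        iota).units
          (Submonoid.powers θ)).subtype) :=
  mrange_pi_diagonalStable'_toRecord C hC hS hl hp2 hpl hζ mods f hf hmods h15 L hZ hcharY hlim c hA hfi O
    hO iota φ₀ s hι hN hφ q hq w hsec θ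
    (topClass_toRecord_family C hC hS hl hp2 hpl hζ mods f hf hmods h15 L hZ hcharY hlim c hA hfi O iota hθ)
    (conj_toRecord_apply C hC hS hl hp2 hpl hζ mods f hf hmods h15 L hZ hcharY hlim c hA hfi O iota) R hR t₀ g

end EtaleLevels

end Literature.IUT.HodgeArakelov
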